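import Summits.QuantumFields.YangMills.Theorems.BalabanUVNodesN15TwoSpacingGluing
import HarnessLib

/-!
# THE GLUING STEP AT TWO LATTICE SPACINGS, II: the η-DEFECT of the glued inverse — `𝔇(N′, N) = N′∘𝔇(R′, R)∘N` EXACTLY, `𝔇(G′, G)` from the η-defects of the
# parametrix and of the remainder (left and right factors riding along), one rate loss per composition (dag-n15-c g11, FILE 44; N15 = NE2, s1 «background-layer
# OPERATOR ingredient»)

Cell `pub-ymgap`, seat `pub-ymgap-dag-n15-c` (R134 (a); HUMAN RULING D-0062), generation 11.  `bears_on: R4∕N15 · K3⁷ SpineGivenEndpointR13SepCoPH (stmt-QuantumFields-20544)`.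
Filed `--supports stmt-QuantumFields-20544 --as helper` — COUNT-NEUTRAL.  One plumbing `def` (`glueInvL`), the rest theorems; 0 `sorry`.  Imports BY NAME FILE 43 `…N15TwoSpacingGluing`
(`neumannR`, `glueInv`, `one_sub_comp_neumannR`, `neumannR_comp_one_sub`, `isUnit_neumannR`, `hasMaj_neumannR`, `eq_glueInv_of_comp_lap`; through it lit `B11SectG.hasMaj_comp_exp`,
`T4EtaRateDefect.idef`∕`idef_comp`∕`idef_inv`, `T4EtaRateCoeffDefect.pull`); nothing in the tree is modified.

WHY.  The spine's NE2 is an η-DIFFERENCE statement (`T4EtaRate`, `T4EtaRateDefect.idef`: the same object at two lattice spacings compared through the block pull-back).  In the printed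
architecture ([Balaban1985BackgroundPropagators] p. 399: cube-localized propagators glued by [Balaban1984PropagatorsII] Sect. 2's generalized random walk ∕ parametrix `G = G₀(I − R)⁻¹`,
(2.91) p. 239, (2.135)–(2.136) p. 247) the η-rate of the GLOBAL propagator must be inherited from the η-rates of the cube propagators and of the partition; FILE 43 resummed the pair at
one spacing; THIS FILE is the two-spacing content: with coarse data `(G₀, R)` on `X` (blocks `blk`) and fine data `(G₀′, R′)` on `X′` (blocks `blk ∘ π`),
* §1 `idef_id_pull`; ★ `idef_neumannR` — EXACT: `𝔇(N′, N) = N′∘𝔇(R′, R)∘N` (`T4EtaRateDefect.idef_inv` at `Δ = 1 − R`: rate = stability × consistency, NO series bookkeeping for the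
  defect); ★★ `hasMaj_idef_neumannR` (`≤ (1−q)⁻²·r·c_r²·e^{−(δ−2σ)d}`, `q = θc_r < 1`, from `R, R′ ≤ θe^{−δd}`, `𝔇(R′,R) ≤ re^{−δd}`); ★★★ **`hasMaj_idef_glueInv`**: `𝔇(G′, G) =
  G₀′∘𝔇(N′,N) + 𝔇(G₀′,G₀)∘N ≤ [A·r·(1−q)⁻²c_r³ + m·(1−q)⁻¹c_r]·e^{−(δ−2σ)d}` for ANY parametrices `G₀′ ≤ Ae^{−δd}`, `𝔇(G₀′,G₀) ≤ me^{−δd}` — hence the (3.42) entries with LEFT factors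
  (`D∘G = (D∘G₀)∘N`, `D = ∇_μ, Δ`: ★★★ `hasMaj_idef_comp_glueInv`);
* §2 the ADJOINT arrangement `glueInvL R̃ G₀ := Ñ ∘ G₀` of a left parametrix pair (`G₀Δ_a = 1 − R̃`, (2.91) transposed) for RIGHT factors (entry 2, `G∘∇* = Ñ∘(G₀∘∇*)`):
  `glueInvL_comp_lap`, `lap_comp_glueInvL`, `glueInvL_eq_glueInv` (the same operator as FILE 43's, uniqueness of the inverse), ★★★ `hasMaj_idef_glueInvL_comp` (`𝔇(Ñ′∘P′, Ñ∘P) =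
  Ñ′∘𝔇(P′,P) + Ñ′∘(𝔇(R̃′,R̃)∘(Ñ∘P))`, rate `δ − 2σ`).

HONEST FRAMING ∕ LIMITS.  Block-majorant bookkeeping (Leibniz + the exact inverse rule + [B6] (2.52)–(2.56) compositions) over DISPLAYED letters of the parametrix pair at both
spacings and of their η-defects ([B6] (2.91), (2.135)–(2.136), [B9] p. 399, Thm 3.14 pp. 426–427 = MECHANISM ∕ TEMPLATE; nothing of [B6]∕[B9] asserted).  The companion
`…N15TwoSpacingGluingCubes` derives those letters from cube-localized propagators and a partition of unity (their own two-grid letters located, not claimed).  NE2⁺ NOT PRINTED, NOT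
proved; N15 NOT discharged; counts of record UNMOVED (typed 28∕28 · discharged 5∕27); one finite 𝕋⁴ at fixed ε — NOT infinite volume, NOT OS on ℝ⁴, NOT a mass gap, NOT Clay; R4
closes the conditional finite-𝕋⁴ rung `BalabanLadder.UV` only.  Restate-immune (no Theses import).
-/

noncomputable section

namespace Summit.QuantumFields.YangMills.BalabanUVNodes.N15.Gluing

open Literature.MathematicalPhysics.QuantumFieldTheory.Balaban1983to89
open Literature.MathematicalPhysics.QuantumFieldTheory.Balaban1983to89.B11SectG (BlockNorm HasMaj RowSum hasMaj_comp_exp)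
open Literature.MathematicalPhysics.QuantumFieldTheory.Balaban1983to89.T4EtaRateDefect (idef idef_apply idef_comp idef_sub idef_inv)
open Literature.MathematicalPhysics.QuantumFieldTheory.Balaban1983to89.T4EtaRateCoeffDefect (pull pull_apply)
open Literature.MathematicalPhysics.QuantumFieldTheory.Balaban1983to89.B6RandomWalk (Triangle254)

/-! ## §1 The η-defect of the resummation (EXACT inverse rule) and of the glued inverse (Leibniz), left factors -/

section Defect

variable {X X' : Type} [Fintype X] [Fintype X'] [DecidableEq X] [DecidableEq X'] {g : B6.Geometry} (blk : X → g.Site) (π : X' → X) {σ cr : ℝ}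

omit [Fintype X] [Fintype X'] [DecidableEq X] [DecidableEq X'] in
/-- The identity maps have no η-defect through a common transport. [folklore] -/
theorem idef_id_pull : idef (pull π) (pull π) (LinearMap.id : (X' → ℝ) →ₗ[ℝ] (X' → ℝ)) (LinearMap.id : (X → ℝ) →ₗ[ℝ] (X → ℝ)) = 0 := by
  refine LinearMap.ext fun μ => ?_
  simp [idef]

/-- ★ **EXACT**: `𝔇(N′, N) = N′ ∘ 𝔇(R′, R) ∘ N` — the η-defect of the resummation is the η-defect of the remainder sandwiched between the two resummations
(`T4EtaRateDefect.idef_inv` at `Δ = 1 − R`; rate = stability × consistency, no series). [folklore] -/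
theorem idef_neumannR {R : (X → ℝ) →ₗ[ℝ] (X → ℝ)} {R' : (X' → ℝ) →ₗ[ℝ] (X' → ℝ)} (hunit : IsUnit (1 - LinearMap.toMatrix' R))
    (hunit' : IsUnit (1 - LinearMap.toMatrix' R')) :
    idef (pull π) (pull π) (neumannR R') (neumannR R) = neumannR R' ∘ₗ idef (pull π) (pull π) R' R ∘ₗ neumannR R := by
  rw [idef_inv (pull π) (pull π) (neumannR_comp_one_sub hunit') (one_sub_comp_neumannR hunit), idef_sub, idef_id_pull, zero_sub,
    LinearMap.neg_comp, LinearMap.comp_neg, neg_neg]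

/-- ★★ **THE η-DEFECT OF THE RESUMMATION**: `R, R′ ≤ θe^{−δd}` (`θc_r < 1`), `𝔇(R′,R) ≤ re^{−δd}`, `2σ ≤ δ` ⟹ `𝔇(N′,N) ≤ (1−θc_r)⁻²·r·c_r²·e^{−(δ−2σ)d}`
(associated as `N′∘(𝔇(R′,R)∘N)`: one rate loss per composition). [cite: Balaban1984PropagatorsII, (2.52)–(2.56) pp.232–233 (mechanism)] -/
theorem hasMaj_idef_neumannR (htri : Triangle254 g) (hd : ∀ a b : g.Site, 0 ≤ g.dist a b) (hd0 : ∀ y : g.Site, g.dist y y = 0) (hrow : RowSum g σ cr) (hσ : 0 ≤ σ)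
    (hcr : 0 ≤ cr) {R : (X → ℝ) →ₗ[ℝ] (X → ℝ)} {R' : (X' → ℝ) →ₗ[ℝ] (X' → ℝ)} {θ r δ : ℝ} (hθ : 0 ≤ θ) (hr : 0 ≤ r) (hσδ : 2 * σ ≤ δ)
    (hR : HasMaj (BlockNorm.ofBlocks g blk) (BlockNorm.ofBlocks g blk) R (fun y y' => θ * Real.exp (-(δ * g.dist y y'))))
    (hR' : HasMaj (BlockNorm.ofBlocks g (blk ∘ π)) (BlockNorm.ofBlocks g (blk ∘ π)) R' (fun y y' => θ * Real.exp (-(δ * g.dist y y'))))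
    (hDR : HasMaj (BlockNorm.ofBlocks g blk) (BlockNorm.ofBlocks g (blk ∘ π)) (idef (pull π) (pull π) R' R) (fun y y' => r * Real.exp (-(δ * g.dist y y'))))
    (hq : θ * cr < 1) :
    HasMaj (BlockNorm.ofBlocks g blk) (BlockNorm.ofBlocks g (blk ∘ π)) (idef (pull π) (pull π) (neumannR R') (neumannR R))
      (fun y y' => (1 - θ * cr)⁻¹ * ((1 - θ * cr)⁻¹ * r * cr) * cr * Real.exp (-((δ - 2 * σ) * g.dist y y'))) := by
  have hσδ' : σ ≤ δ := by linarith
  have hunit := isUnit_neumannR blk hd hrow hθ hσδ' hR hq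
  have hunit' := isUnit_neumannR (blk ∘ π) hd hrow hθ hσδ' hR' hq
  have hinv0 : 0 ≤ (1 - θ * cr)⁻¹ := inv_nonneg.2 (by linarith)
  have hN := hasMaj_neumannR blk htri hd hd0 hrow (ρ := δ - σ) hθ (by linarith) (by linarith) hR hq
  have hN' := hasMaj_neumannR (blk ∘ π) htri hd hd0 hrow (ρ := δ - σ) hθ (by linarith) (by linarith) hR' hq
  -- inner composition `𝔇(R′,R) ∘ N` at rate `δ − σ`
  have h1 := hasMaj_comp_exp (b₁ := BlockNorm.ofBlocks g blk) (b₂ := BlockNorm.ofBlocks g blk) (b₃ := BlockNorm.ofBlocks g (blk ∘ π))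
    (T₁ := idef (pull π) (pull π) R' R) (T₂ := neumannR R) (ρ := δ - σ) htri hd hrow hr hinv0 (by linarith) le_rfl (by linarith) hDR hN
  have h1' : HasMaj (BlockNorm.ofBlocks g blk) (BlockNorm.ofBlocks g (blk ∘ π)) (idef (pull π) (pull π) R' R ∘ₗ neumannR R)
      (fun y y' => (1 - θ * cr)⁻¹ * r * cr * Real.exp (-((δ - σ) * g.dist y y'))) := by
    refine h1.mono fun a b => le_of_eq ?_
    rw [show (BlockNorm.ofBlocks g blk).κ = 1 from rfl]
    ring
  -- outer composition `N′ ∘ (𝔇(R′,R) ∘ N)` at rate `δ − 2σ`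
  have h2 := hasMaj_comp_exp (b₁ := BlockNorm.ofBlocks g blk) (b₂ := BlockNorm.ofBlocks g (blk ∘ π)) (b₃ := BlockNorm.ofBlocks g (blk ∘ π))
    (T₁ := neumannR R') (T₂ := idef (pull π) (pull π) R' R ∘ₗ neumannR R) (ρ := δ - 2 * σ) htri hd hrow hinv0
    (mul_nonneg (mul_nonneg hinv0 hr) hcr) (by linarith) (by linarith) (by linarith) hN' h1'
  rw [idef_neumannR π hunit hunit']
  refine h2.mono fun a b => le_of_eq ?_
  rw [show (BlockNorm.ofBlocks g (blk ∘ π)).κ = 1 from rfl]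
  ring

/-- ★★★ **THE η-DEFECT OF THE GLUED INVERSE.**  For ANY coarse∕fine parametrices `G₀ ≤ Ae^{−δd}` (fine), remainders `R, R′ ≤ θe^{−δd}` with `θc_r < 1`, and the
η-defects `𝔇(G₀′, G₀) ≤ me^{−δd}`, `𝔇(R′, R) ≤ re^{−δd}` through the block pull-back, the glued inverses `G = G₀∘(1 − R)⁻¹`, `G′ = G₀′∘(1 − R′)⁻¹` satisfy
`𝔇(G′, G) = G₀′∘𝔇(N′,N) + 𝔇(G₀′,G₀)∘N ≤ [A·(1−θc_r)⁻²·r·c_r³ + m·(1−θc_r)⁻¹·c_r]·e^{−(δ−2σ)d}` (`2σ ≤ δ`).  The two-spacing edition of [B6]'s «Reasoning in the same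
way as in the proof of Proposition 2.2 we obtain Proposition 2.6»: the η-rate of the global propagator is INHERITED from the η-rates of the parametrix and of the remainder,
the smallness of `R` (the `M ≥ M₁` guard) being the only convergence input. [cite: Balaban1984PropagatorsII, (2.91) p.239, (2.135)–(2.136) p.247 (mechanism); Balaban1985BackgroundPropagators, p.399 (architecture), Thm 3.14 pp.426–427 (difference template)] -/
theorem hasMaj_idef_glueInv (htri : Triangle254 g) (hd : ∀ a b : g.Site, 0 ≤ g.dist a b) (hd0 : ∀ y : g.Site, g.dist y y = 0) (hrow : RowSum g σ cr) (hσ : 0 ≤ σ)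
    (hcr : 0 ≤ cr) {G₀ R : (X → ℝ) →ₗ[ℝ] (X → ℝ)} {G₀' R' : (X' → ℝ) →ₗ[ℝ] (X' → ℝ)} {A θ m r δ : ℝ} (hA : 0 ≤ A) (hθ : 0 ≤ θ) (hm : 0 ≤ m) (hr : 0 ≤ r)
    (hσδ : 2 * σ ≤ δ)
    (hG₀' : HasMaj (BlockNorm.ofBlocks g (blk ∘ π)) (BlockNorm.ofBlocks g (blk ∘ π)) G₀' (fun y y' => A * Real.exp (-(δ * g.dist y y'))))
    (hR : HasMaj (BlockNorm.ofBlocks g blk) (BlockNorm.ofBlocks g blk) R (fun y y' => θ * Real.exp (-(δ * g.dist y y'))))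
    (hR' : HasMaj (BlockNorm.ofBlocks g (blk ∘ π)) (BlockNorm.ofBlocks g (blk ∘ π)) R' (fun y y' => θ * Real.exp (-(δ * g.dist y y'))))
    (hDG₀ : HasMaj (BlockNorm.ofBlocks g blk) (BlockNorm.ofBlocks g (blk ∘ π)) (idef (pull π) (pull π) G₀' G₀) (fun y y' => m * Real.exp (-(δ * g.dist y y'))))
    (hDR : HasMaj (BlockNorm.ofBlocks g blk) (BlockNorm.ofBlocks g (blk ∘ π)) (idef (pull π) (pull π) R' R) (fun y y' => r * Real.exp (-(δ * g.dist y y'))))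
    (hq : θ * cr < 1) :
    HasMaj (BlockNorm.ofBlocks g blk) (BlockNorm.ofBlocks g (blk ∘ π)) (idef (pull π) (pull π) (glueInv G₀' R') (glueInv G₀ R))
      (fun y y' => (A * ((1 - θ * cr)⁻¹ * ((1 - θ * cr)⁻¹ * r * cr) * cr) * cr + m * (1 - θ * cr)⁻¹ * cr) * Real.exp (-((δ - 2 * σ) * g.dist y y'))) := by
  have hinv0 : 0 ≤ (1 - θ * cr)⁻¹ := inv_nonneg.2 (by linarith)
  have hN := hasMaj_neumannR blk htri hd hd0 hrow (ρ := δ - σ) hθ (by linarith) (by linarith) hR hq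
  have hDN := hasMaj_idef_neumannR blk π htri hd hd0 hrow hσ hcr hθ hr hσδ hR hR' hDR hq
  -- term 1: `G₀′ ∘ 𝔇(N′,N)` at rate `δ − 2σ` (margin from `G₀′`)
  have h1 := hasMaj_comp_exp (b₁ := BlockNorm.ofBlocks g blk) (b₂ := BlockNorm.ofBlocks g (blk ∘ π)) (b₃ := BlockNorm.ofBlocks g (blk ∘ π))
    (T₁ := G₀') (T₂ := idef (pull π) (pull π) (neumannR R') (neumannR R)) (ρ := δ - 2 * σ) htri hd hrow hA
    (mul_nonneg (mul_nonneg hinv0 (mul_nonneg (mul_nonneg hinv0 hr) hcr)) hcr) (by linarith) le_rfl (by linarith) hG₀' hDN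
  -- term 2: `𝔇(G₀′,G₀) ∘ N` at rate `δ − σ`, weakened to `δ − 2σ`
  have h2 := hasMaj_comp_exp (b₁ := BlockNorm.ofBlocks g blk) (b₂ := BlockNorm.ofBlocks g blk) (b₃ := BlockNorm.ofBlocks g (blk ∘ π))
    (T₁ := idef (pull π) (pull π) G₀' G₀) (T₂ := neumannR R) (ρ := δ - 2 * σ) htri hd hrow hm hinv0 (by linarith) (by linarith) (by linarith) hDG₀ hN
  rw [glueInv, glueInv, idef_comp (pull π) (pull π) (pull π)]
  refine (h1.add h2).mono fun a b => le_of_eq ?_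
  rw [show (BlockNorm.ofBlocks g blk).κ = 1 from rfl, show (BlockNorm.ofBlocks g (blk ∘ π)).κ = 1 from rfl]
  ring

/-- **THE (3.42) ENTRIES WITH LEFT FACTORS ride along**: `D∘G = (D∘G₀)∘N`, so `𝔇(D′∘G′, D∘G)` obeys ★★★ with the parametrix replaced by the left-dressed parametrix
`D∘G₀` (entries 1 and 3: `D = ∇_μ`, `Δ`; its letters come from the cubes' (2.133)-type second entries in FILE 44). [cite: Balaban1984PropagatorsII, Prop. 2.6 (2.136) p.247 (entries: shape)] -/
theorem hasMaj_idef_comp_glueInv (htri : Triangle254 g) (hd : ∀ a b : g.Site, 0 ≤ g.dist a b) (hd0 : ∀ y : g.Site, g.dist y y = 0) (hrow : RowSum g σ cr) (hσ : 0 ≤ σ)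
    (hcr : 0 ≤ cr) {D G₀ R : (X → ℝ) →ₗ[ℝ] (X → ℝ)} {D' G₀' R' : (X' → ℝ) →ₗ[ℝ] (X' → ℝ)} {A θ m r δ : ℝ} (hA : 0 ≤ A) (hθ : 0 ≤ θ) (hm : 0 ≤ m) (hr : 0 ≤ r)
    (hσδ : 2 * σ ≤ δ)
    (hDG₀' : HasMaj (BlockNorm.ofBlocks g (blk ∘ π)) (BlockNorm.ofBlocks g (blk ∘ π)) (D' ∘ₗ G₀') (fun y y' => A * Real.exp (-(δ * g.dist y y'))))
    (hR : HasMaj (BlockNorm.ofBlocks g blk) (BlockNorm.ofBlocks g blk) R (fun y y' => θ * Real.exp (-(δ * g.dist y y'))))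
    (hR' : HasMaj (BlockNorm.ofBlocks g (blk ∘ π)) (BlockNorm.ofBlocks g (blk ∘ π)) R' (fun y y' => θ * Real.exp (-(δ * g.dist y y'))))
    (hDDG₀ : HasMaj (BlockNorm.ofBlocks g blk) (BlockNorm.ofBlocks g (blk ∘ π)) (idef (pull π) (pull π) (D' ∘ₗ G₀') (D ∘ₗ G₀))
      (fun y y' => m * Real.exp (-(δ * g.dist y y'))))
    (hDR : HasMaj (BlockNorm.ofBlocks g blk) (BlockNorm.ofBlocks g (blk ∘ π)) (idef (pull π) (pull π) R' R) (fun y y' => r * Real.exp (-(δ * g.dist y y'))))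
    (hq : θ * cr < 1) :
    HasMaj (BlockNorm.ofBlocks g blk) (BlockNorm.ofBlocks g (blk ∘ π)) (idef (pull π) (pull π) (D' ∘ₗ glueInv G₀' R') (D ∘ₗ glueInv G₀ R))
      (fun y y' => (A * ((1 - θ * cr)⁻¹ * ((1 - θ * cr)⁻¹ * r * cr) * cr) * cr + m * (1 - θ * cr)⁻¹ * cr) * Real.exp (-((δ - 2 * σ) * g.dist y y'))) := by
  have key := hasMaj_idef_glueInv blk π htri hd hd0 hrow hσ hcr (G₀ := D ∘ₗ G₀) (G₀' := D' ∘ₗ G₀') hA hθ hm hr hσδ hDG₀' hR hR' hDDG₀ hDR hq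
  rw [glueInv, glueInv, LinearMap.comp_assoc, LinearMap.comp_assoc] at key
  rw [glueInv, glueInv]
  exact key

end Defect

/-! ## §2 The adjoint arrangement `G = (1 − R̃)⁻¹ ∘ G₀` for entries with RIGHT factors (`G∘∇*`) -/

section Adjoint

variable {X X' : Type} [Fintype X] [Fintype X'] [DecidableEq X] [DecidableEq X'] {g : B6.Geometry} (blk : X → g.Site) (π : X' → X) {σ cr : ℝ}

/-- THE ADJOINT GLUED INVERSE `G := (1 − R̃)⁻¹ ∘ G₀` of a LEFT parametrix pair (`G₀Δ_a = 1 − R̃`, the transposed reading of (2.91)) — the arrangement in which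
RIGHT factors ride along: `G∘E = Ñ∘(G₀∘E)` (entry 2 of (3.42), `E = ∇*`). [cite: Balaban1984PropagatorsII, (2.91) p.239 (shape, transposed)] -/
def glueInvL (R G₀ : (X → ℝ) →ₗ[ℝ] (X → ℝ)) : (X → ℝ) →ₗ[ℝ] (X → ℝ) := neumannR R ∘ₗ G₀

/-- `G₀Δ_a = 1 − R̃` and `1 − [R̃]` a unit ⟹ `G ∘ Δ_a = 1`. [cite: Balaban1984PropagatorsII, (2.91) p.239 (transposed)] -/
theorem glueInvL_comp_lap {Δa G₀ R : (X → ℝ) →ₗ[ℝ] (X → ℝ)} (hunit : IsUnit (1 - LinearMap.toMatrix' R)) (h291 : G₀ ∘ₗ Δa = LinearMap.id - R) :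
    glueInvL R G₀ ∘ₗ Δa = LinearMap.id := by
  rw [glueInvL, LinearMap.comp_assoc, h291, neumannR_comp_one_sub hunit]

/-- Finite dimension: also a right inverse, `Δ_a ∘ G = 1`. [folklore] -/
theorem lap_comp_glueInvL {Δa G₀ R : (X → ℝ) →ₗ[ℝ] (X → ℝ)} (hunit : IsUnit (1 - LinearMap.toMatrix' R)) (h291 : G₀ ∘ₗ Δa = LinearMap.id - R) :
    Δa ∘ₗ glueInvL R G₀ = LinearMap.id := by
  have h := congrArg LinearMap.toMatrix' (glueInvL_comp_lap hunit h291)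
  rw [LinearMap.toMatrix'_comp, LinearMap.toMatrix'_id, mul_eq_one_comm] at h
  apply LinearMap.toMatrix'.injective
  rw [LinearMap.toMatrix'_comp, LinearMap.toMatrix'_id, h]

/-- The two arrangements give THE SAME operator whenever both parametrix identities hold (uniqueness of the inverse). [folklore] -/
theorem glueInvL_eq_glueInv {Δa G₀ R Rt : (X → ℝ) →ₗ[ℝ] (X → ℝ)} (hunit : IsUnit (1 - LinearMap.toMatrix' R)) (hunitt : IsUnit (1 - LinearMap.toMatrix' Rt))
    (h291 : Δa ∘ₗ G₀ = LinearMap.id - R) (h291t : G₀ ∘ₗ Δa = LinearMap.id - Rt) : glueInvL Rt G₀ = glueInv G₀ R :=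
  eq_glueInv_of_comp_lap hunit h291 (glueInvL_comp_lap hunitt h291t)

/-- ★★★ **THE η-DEFECT OF THE ADJOINT ARRANGEMENT WITH A RIGHT FACTOR**: for ANY right-dressed parametrices `P = G₀∘E ≤ Ae^{−δd}` (coarse) with η-defect
`𝔇(P′,P) ≤ me^{−δd}` and remainders as in §4, `𝔇(Ñ′∘P′, Ñ∘P) = Ñ′∘𝔇(P′,P) + Ñ′∘(𝔇(R̃′,R̃)∘(Ñ∘P)) ≤ [m·(1−q)⁻¹c_r + A·r·(1−q)⁻²c_r³]·e^{−(δ−2σ)d}` (`q = θc_r < 1`,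
`2σ ≤ δ`) — entry 2 of (3.42) for the glued inverse. [cite: Balaban1984PropagatorsII, Prop. 2.6 (2.136) p.247 (entries: shape); (2.52)–(2.56) pp.232–233 (mechanism)] -/
theorem hasMaj_idef_glueInvL_comp (htri : Triangle254 g) (hd : ∀ a b : g.Site, 0 ≤ g.dist a b) (hd0 : ∀ y : g.Site, g.dist y y = 0) (hrow : RowSum g σ cr) (hσ : 0 ≤ σ)
    (hcr : 0 ≤ cr) {P R : (X → ℝ) →ₗ[ℝ] (X → ℝ)} {P' R' : (X' → ℝ) →ₗ[ℝ] (X' → ℝ)} {A θ m r δ : ℝ} (hA : 0 ≤ A) (hθ : 0 ≤ θ) (hm : 0 ≤ m) (hr : 0 ≤ r)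
    (hσδ : 2 * σ ≤ δ)
    (hP : HasMaj (BlockNorm.ofBlocks g blk) (BlockNorm.ofBlocks g blk) P (fun y y' => A * Real.exp (-(δ * g.dist y y'))))
    (hR : HasMaj (BlockNorm.ofBlocks g blk) (BlockNorm.ofBlocks g blk) R (fun y y' => θ * Real.exp (-(δ * g.dist y y'))))
    (hR' : HasMaj (BlockNorm.ofBlocks g (blk ∘ π)) (BlockNorm.ofBlocks g (blk ∘ π)) R' (fun y y' => θ * Real.exp (-(δ * g.dist y y'))))
    (hDP : HasMaj (BlockNorm.ofBlocks g blk) (BlockNorm.ofBlocks g (blk ∘ π)) (idef (pull π) (pull π) P' P) (fun y y' => m * Real.exp (-(δ * g.dist y y'))))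
    (hDR : HasMaj (BlockNorm.ofBlocks g blk) (BlockNorm.ofBlocks g (blk ∘ π)) (idef (pull π) (pull π) R' R) (fun y y' => r * Real.exp (-(δ * g.dist y y'))))
    (hq : θ * cr < 1) :
    HasMaj (BlockNorm.ofBlocks g blk) (BlockNorm.ofBlocks g (blk ∘ π)) (idef (pull π) (pull π) (neumannR R' ∘ₗ P') (neumannR R ∘ₗ P))
      (fun y y' => ((1 - θ * cr)⁻¹ * m * cr + (1 - θ * cr)⁻¹ * (r * ((1 - θ * cr)⁻¹ * A * cr) * cr) * cr) * Real.exp (-((δ - 2 * σ) * g.dist y y'))) := by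
  have hσδ' : σ ≤ δ := by linarith
  have hunit := isUnit_neumannR blk hd hrow hθ hσδ' hR hq
  have hunit' := isUnit_neumannR (blk ∘ π) hd hrow hθ hσδ' hR' hq
  have hinv0 : 0 ≤ (1 - θ * cr)⁻¹ := inv_nonneg.2 (by linarith)
  have hN := hasMaj_neumannR blk htri hd hd0 hrow (ρ := δ - σ) hθ (by linarith) (by linarith) hR hq
  have hN' := hasMaj_neumannR (blk ∘ π) htri hd hd0 hrow (ρ := δ - σ) hθ (by linarith) (by linarith) hR' hq
  -- term 1: `Ñ′ ∘ 𝔇(P′,P)` at rate `δ − 2σ`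
  have h1 := hasMaj_comp_exp (b₁ := BlockNorm.ofBlocks g blk) (b₂ := BlockNorm.ofBlocks g (blk ∘ π)) (b₃ := BlockNorm.ofBlocks g (blk ∘ π))
    (T₁ := neumannR R') (T₂ := idef (pull π) (pull π) P' P) (ρ := δ - 2 * σ) htri hd hrow hinv0 hm (by linarith) (by linarith) (by linarith) hN' hDP
  -- term 2: `Ñ′ ∘ (𝔇(R̃′,R̃) ∘ (Ñ ∘ P))`, innermost first
  have h2a := hasMaj_comp_exp (b₁ := BlockNorm.ofBlocks g blk) (b₂ := BlockNorm.ofBlocks g blk) (b₃ := BlockNorm.ofBlocks g blk)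
    (T₁ := neumannR R) (T₂ := P) (ρ := δ - 2 * σ) htri hd hrow hinv0 hA (by linarith) (by linarith) (by linarith) hN hP
  have h2a' : HasMaj (BlockNorm.ofBlocks g blk) (BlockNorm.ofBlocks g blk) (neumannR R ∘ₗ P)
      (fun y y' => (1 - θ * cr)⁻¹ * A * cr * Real.exp (-((δ - 2 * σ) * g.dist y y'))) := by
    refine h2a.mono fun a b => le_of_eq ?_
    rw [show (BlockNorm.ofBlocks g blk).κ = 1 from rfl]
    ring
  have h2b := hasMaj_comp_exp (b₁ := BlockNorm.ofBlocks g blk) (b₂ := BlockNorm.ofBlocks g blk) (b₃ := BlockNorm.ofBlocks g (blk ∘ π))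
    (T₁ := idef (pull π) (pull π) R' R) (T₂ := neumannR R ∘ₗ P) (ρ := δ - 2 * σ) htri hd hrow hr (mul_nonneg (mul_nonneg hinv0 hA) hcr)
    (by linarith) le_rfl (by linarith) hDR h2a'
  have h2b' : HasMaj (BlockNorm.ofBlocks g blk) (BlockNorm.ofBlocks g (blk ∘ π)) (idef (pull π) (pull π) R' R ∘ₗ (neumannR R ∘ₗ P))
      (fun y y' => r * ((1 - θ * cr)⁻¹ * A * cr) * cr * Real.exp (-((δ - 2 * σ) * g.dist y y'))) := by
    refine h2b.mono fun a b => le_of_eq ?_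
    rw [show (BlockNorm.ofBlocks g blk).κ = 1 from rfl]
    ring
  have h2c := hasMaj_comp_exp (b₁ := BlockNorm.ofBlocks g blk) (b₂ := BlockNorm.ofBlocks g (blk ∘ π)) (b₃ := BlockNorm.ofBlocks g (blk ∘ π))
    (T₁ := neumannR R') (T₂ := idef (pull π) (pull π) R' R ∘ₗ (neumannR R ∘ₗ P)) (ρ := δ - 2 * σ) htri hd hrow hinv0
    (mul_nonneg (mul_nonneg hr (mul_nonneg (mul_nonneg hinv0 hA) hcr)) hcr) (by linarith) le_rfl (by linarith) hN' h2b'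
  -- assemble
  have hop : idef (pull π) (pull π) (neumannR R' ∘ₗ P') (neumannR R ∘ₗ P) =
      neumannR R' ∘ₗ idef (pull π) (pull π) P' P + neumannR R' ∘ₗ (idef (pull π) (pull π) R' R ∘ₗ (neumannR R ∘ₗ P)) := by
    rw [idef_comp (pull π) (pull π) (pull π), idef_neumannR π hunit hunit', LinearMap.comp_assoc, LinearMap.comp_assoc]
  rw [hop]
  refine (h1.add h2c).mono fun a b => le_of_eq ?_
  rw [show (BlockNorm.ofBlocks g (blk ∘ π)).κ = 1 from rfl]
  ring

end Adjoint

end Summit.QuantumFields.YangMills.BalabanUVNodes.N15.Gluing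

end
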